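import Summits.QuantumFields.YangMills.Theorems.UVSeamRec.Negative.PenetrationLaplace
import Summits.QuantumFields.YangMills.Theorems.BalabanLadderNTBoundaryLawSymmetry
import HarnessLib

/-!
# A classical funnel law refutes penetration at every rate above `d⁻⁴`

Sequel to `…Theorems.UVSeamRec.Negative.PenetrationLaplace` (the `β → ∞` Laplace reduction for the cube kernel
`kerE`).  There it is shown that a *classical plateau* (a ground-state gap of size `≳ ρ(d)` between two exteriors)
implies `PlanePenetrationAtRate ρ` / `DensPenetrationAtRate ρ`.  Here we prove the converse reduction: a
*classical funnel law* — a uniform constant `K` such that in **every** ground state of **every** cube with **every**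
exterior the single-plane deficit `N − Re tr U_p` (resp. the action-density deficit) at a site of depth `d ≥ 2` is at
most `K / d⁴` — makes `PlanePenetrationAtRate ρ` (resp. `DensPenetrationAtRate ρ`) impossible for every rate with
`ρ(n)·n⁴ → ∞`, in particular for the rate `ρ(n) = 1/n²` wanted by the ladder
(`BalabanLadder.NT` / `UVSeamRec` via `not_fbl6_of_planePenetrationAtRate`).

Mechanism: by `kerE_eventually_ge/le`, for `β → ∞` the kernel expectation of a continuous field is squeezed into
`[min over ground states − ε, max over ground states + ε]`; under the funnel law both exteriors give expectations in
`[M − K/d⁴ − ε, M + ε]` (`M` the a-priori flat upper bound), so the response is `≤ K/d⁴ + 2ε = o(ρ(d))`.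

Together with the plateau direction this brackets the `β → ∞` content of the penetration target between two purely
classical variational statements about Wilson-action minimisers in `b⁴` boxes (plateau `θ/d²` versus funnel `K/d⁴`);
neither is decided here.

Main declarations (namespace `Summit.QuantumFields.YangMills.Cruxes.UVSeamRec.BoundaryLawPenetration`):
* `ClassicalPlaneFunnel`, `ClassicalDensFunnel` — the funnel laws (statements only);
* `plane_le_N`, `dens_le_six_N` — a-priori flat upper bounds;
* `no_rate_response_of_funnel` — the abstract squeeze;
* `not_planePenetrationAtRate_of_classicalPlaneFunnel`, `not_densPenetrationAtRate_of_classicalDensFunnel` and the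
  `1/n²` specialisations.

References: folklore zero-temperature Laplace asymptotics [cite: Hwang1980]; unitarity bound `Re tr ≤ N`
[cite: arXiv180301950, §2].
-/

open MeasureTheory Filter Topology
open Literature.MathematicalPhysics.QuantumFieldTheory Literature.MathematicalPhysics.QuantumLattice
open Literature.Probability.LatticeModels
open Summit.QuantumFields.YangMills.Cruxes.OSLegsFromFemtoAndGap.DlrCollarTransfer
open Summit.QuantumFields.YangMills.Cruxes.NT.BoundaryLaw (plane_eq_plaquetteObs)

namespace Summit.QuantumFields.YangMills.Cruxes.UVSeamRec.BoundaryLawPenetration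

variable (G : Type) [Group G] [TopologicalSpace G] [IsTopologicalGroup G] [CompactSpace G]
  [MeasurableSpace G] [BorelSpace G] (r : LatticeRep G)

/-- **Classical funnel law (single plane).**  One constant `K` such that for every plaquette orientation `q`, every
cube `(c, b)`, every exterior `η` and every ground state `ζ` of the boundary Wilson action, the plane deficit
`N − Re tr U_p` at a site `x` of depth `d ≥ 2` is at most `K / d⁴`.  (The dimensional `d⁻⁴` law of a spreading
flux; a statement about classical minimisers only.) -/
def ClassicalPlaneFunnel : Prop :=
  ∃ K : ℝ, ∀ q : Fin 4 × Fin 4, q.1 < q.2 → ∀ (c : Fin 4 → ℤ) (b : ℕ) (x : Fin 4 → ℤ) (η : LGConfig 4 G),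
    2 ≤ depth c b x → ∀ ζ ∈ cubeMinimisers G r c b η,
      (r.N : ℝ) - plane G r q x (glueWith (cubeEdges c b) ζ η) ≤ K / (depth c b x : ℝ) ^ 4

/-- **Classical funnel law (action density).**  Same with the action density at `x`, whose flat value is
`Σ_{i<j} N = 6 N`. -/
def ClassicalDensFunnel : Prop :=
  ∃ K : ℝ, ∀ (c : Fin 4 → ℤ) (b : ℕ) (x : Fin 4 → ℤ) (η : LGConfig 4 G),
    2 ≤ depth c b x → ∀ ζ ∈ cubeMinimisers G r c b η,
      6 * (r.N : ℝ) - dens G r x (glueWith (cubeEdges c b) ζ η) ≤ K / (depth c b x : ℝ) ^ 4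

variable {G r}

/-! ### A-priori flat upper bounds -/

omit [IsTopologicalGroup G] [CompactSpace G] [BorelSpace G] in
/-- `plane ≤ N` (unitarity). [cite: arXiv180301950, §2] -/
theorem plane_le_N (q : Fin 4 × Fin 4) (x : Fin 4 → ℤ) (U : LGConfig 4 G) : plane G r q x U ≤ r.N := by
  rw [plane_eq_plaquetteObs G r]
  exact (le_abs_self _).trans (abs_plaquetteObs_le_holds r.ρ r.mem_unitary x q.1 q.2 U)

/-- `dens ≤ 6 N` (unitarity, six plaquette orientations). [cite: arXiv180301950, §2] -/
theorem dens_le_six_N (x : Fin 4 → ℤ) (U : LGConfig 4 G) : dens G r x U ≤ 6 * (r.N : ℝ) := by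
  show actionDensity r.ρ (configShift (-x) U) ≤ 6 * (r.N : ℝ)
  unfold actionDensity
  have hle : ∀ i j : Fin 4, (if i < j then plaquetteObs r.ρ 0 i j (configShift (-x) U) else 0) ≤
      (if i < j then (r.N : ℝ) else 0) := by
    intro i j
    split_ifs with hij
    · exact (le_abs_self _).trans (abs_plaquetteObs_le_holds r.ρ r.mem_unitary 0 i j _)
    · exact le_rfl
  calc (∑ i : Fin 4, ∑ j : Fin 4, if i < j then plaquetteObs r.ρ 0 i j (configShift (-x) U) else 0)
      ≤ ∑ i : Fin 4, ∑ j : Fin 4, (if i < j then (r.N : ℝ) else 0) :=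
        Finset.sum_le_sum fun i _ => Finset.sum_le_sum fun j _ => hle i j
    _ = 6 * (r.N : ℝ) := by
        simp only [Fin.sum_univ_four]
        simp [Fin.lt_def]
        ring

/-! ### The squeeze -/

section Laplace

variable [SecondCountableTopology G]

/-- **No rate response under a funnel law.**  If a continuous site field `F x` has an a-priori upper bound `M x`
attained up to `K / d⁴` in every ground state of every cube at depth `d ≥ 2`, then its `β → ∞` kernel response to a
change of exterior cannot be `≥ θ ρ(d)` along deep sites for any rate with `ρ(n) n⁴ → ∞`. [folklore] -/
theorem no_rate_response_of_funnel {ρ : ℕ → ℝ} (hρ : Tendsto (fun n : ℕ => ρ n * (n : ℝ) ^ 4) atTop atTop)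
    {θ : ℝ} (hθ : 0 < θ) {F : (Fin 4 → ℤ) → LGConfig 4 G → ℝ} (hF : ∀ x, Continuous (F x))
    {M : (Fin 4 → ℤ) → ℝ} (hM : ∀ x U, F x U ≤ M x) {K : ℝ}
    (hK : ∀ (c : Fin 4 → ℤ) (b : ℕ) (x : Fin 4 → ℤ) (η : LGConfig 4 G), 2 ≤ depth c b x →
      ∀ ζ ∈ cubeMinimisers G r c b η, M x - F x (glueWith (cubeEdges c b) ζ η) ≤ K / (depth c b x : ℝ) ^ 4)
    (hP : ∀ d₀ : ℕ, 1 ≤ d₀ → ∃ (c : Fin 4 → ℤ) (b : ℕ) (x : Fin 4 → ℤ) (η η' : LGConfig 4 G),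
      d₀ ≤ depth c b x ∧ 2 ≤ depth c b x ∧ ∃ β₀ : ℝ, ∀ β : ℝ, β₀ ≤ β →
        θ * ρ (depth c b x) ≤ |kerE G r β c b η (F x) - kerE G r β c b η' (F x)|) : False := by
  -- a depth threshold beyond which `θ ρ(n) n⁴ ≥ 2 K + θ` and `ρ(n) n⁴ ≥ 1`
  have hev : ∀ᶠ n : ℕ in atTop, 2 * K + θ ≤ θ * (ρ n * (n : ℝ) ^ 4) ∧ 1 ≤ ρ n * (n : ℝ) ^ 4 :=
    ((hρ.const_mul_atTop hθ).eventually_ge_atTop _).and (hρ.eventually_ge_atTop _)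
  obtain ⟨N₀, hN₀⟩ := Filter.eventually_atTop.1 hev
  obtain ⟨c, b, x, η, η', hd₀, h2, β₀, hβ⟩ := hP (max N₀ 1) (le_max_right _ _)
  obtain ⟨hthr, hone⟩ := hN₀ (depth c b x) (le_trans (le_max_left _ _) hd₀)
  have hd4 : (0 : ℝ) < (depth c b x : ℝ) ^ 4 := by
    have : (0 : ℝ) < (depth c b x : ℝ) := by exact_mod_cast (by omega : 0 < depth c b x)
    positivity
  have hρpos : 0 < ρ (depth c b x) := by
    by_contra hle
    nlinarith [not_lt.1 hle, hone, hd4]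
  have hε : 0 < θ * ρ (depth c b x) / 4 := by positivity
  -- Laplace squeeze for both exteriors
  have hlo : ∀ ξ : LGConfig 4 G, ∀ᶠ β : ℝ in atTop,
      (M x - K / (depth c b x : ℝ) ^ 4) - θ * ρ (depth c b x) / 4 ≤ kerE G r β c b ξ (F x) := fun ξ =>
    kerE_eventually_ge c b ξ (hF x) (fun ζ hζ => by have := hK c b x ξ h2 ζ hζ; linarith) hε
  have hhi : ∀ ξ : LGConfig 4 G, ∀ᶠ β : ℝ in atTop, kerE G r β c b ξ (F x) ≤ M x + θ * ρ (depth c b x) / 4 :=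
    fun ξ => kerE_eventually_le c b ξ (hF x) (fun ζ _ => hM x _) hε
  obtain ⟨β, h1, h2', h3, h4, h5⟩ :=
    ((hlo η).and ((hhi η).and ((hlo η').and ((hhi η').and (eventually_ge_atTop β₀))))).exists
  have hresp := hβ β h5
  have habs : |kerE G r β c b η (F x) - kerE G r β c b η' (F x)| ≤
      K / (depth c b x : ℝ) ^ 4 + 2 * (θ * ρ (depth c b x) / 4) :=
    abs_sub_le_iff.2 ⟨by linarith, by linarith⟩
  -- `θ ρ(d) / 2 ≤ K / d⁴`, against the threshold
  have hA : θ * ρ (depth c b x) / 2 * (depth c b x : ℝ) ^ 4 ≤ K := (le_div_iff₀ hd4).1 (by linarith)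
  have hA' : θ * (ρ (depth c b x) * (depth c b x : ℝ) ^ 4) ≤ 2 * K := by
    have : θ * ρ (depth c b x) / 2 * (depth c b x : ℝ) ^ 4 = θ * (ρ (depth c b x) * (depth c b x : ℝ) ^ 4) / 2 := by
      ring
    linarith [this ▸ hA]
  linarith

/-- **Funnel ⇒ no plane penetration at any rate above `d⁻⁴`.** [folklore] -/
theorem not_planePenetrationAtRate_of_classicalPlaneFunnel (hfun : ClassicalPlaneFunnel G r) {ρ : ℕ → ℝ}
    (hρ : Tendsto (fun n : ℕ => ρ n * (n : ℝ) ^ 4) atTop atTop) : ¬ PlanePenetrationAtRate G r ρ := by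
  rintro ⟨q, θ, hq, hθ, hP⟩
  obtain ⟨K, hK⟩ := hfun
  exact no_rate_response_of_funnel hρ hθ (F := fun x => plane G r q x) (fun x => continuous_plane r q x)
    (M := fun _ => (r.N : ℝ)) (fun x U => plane_le_N q x U) (hK q hq) hP

/-- The rate `1/n²` of the ladder: a classical plane funnel law refutes `PlanePenetrationAtRate (1/n²)`. [folklore] -/
theorem not_planePenetrationAtRate_inv_sq_of_classicalPlaneFunnel (hfun : ClassicalPlaneFunnel G r) :
    ¬ PlanePenetrationAtRate G r (fun n => 1 / (n : ℝ) ^ 2) :=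
  not_planePenetrationAtRate_of_classicalPlaneFunnel hfun tendsto_inv_sq_mul_pow_four

/-- **Funnel ⇒ no density penetration at any rate above `d⁻⁴`.** [folklore] -/
theorem not_densPenetrationAtRate_of_classicalDensFunnel (hfun : ClassicalDensFunnel G r) {ρ : ℕ → ℝ}
    (hρ : Tendsto (fun n : ℕ => ρ n * (n : ℝ) ^ 4) atTop atTop) : ¬ DensPenetrationAtRate G r ρ := by
  rintro ⟨θ, hθ, hP⟩
  obtain ⟨K, hK⟩ := hfun
  exact no_rate_response_of_funnel hρ hθ (F := dens G r) (fun x => continuous_dens r x)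
    (M := fun _ => 6 * (r.N : ℝ)) (fun x U => dens_le_six_N x U) hK hP

/-- The rate `1/n²`: a classical density funnel law refutes `DensPenetrationAtRate (1/n²)`. [folklore] -/
theorem not_densPenetrationAtRate_inv_sq_of_classicalDensFunnel (hfun : ClassicalDensFunnel G r) :
    ¬ DensPenetrationAtRate G r (fun n => 1 / (n : ℝ) ^ 2) :=
  not_densPenetrationAtRate_of_classicalDensFunnel hfun tendsto_inv_sq_mul_pow_four

end Laplace

end Summit.QuantumFields.YangMills.Cruxes.UVSeamRec.BoundaryLawPenetration
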